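import Mathlib.NumberTheory.Padics.PadicVal.Basic
import Mathlib.Data.Nat.Choose.Factorization
import Mathlib.Tactic
import HarnessLib

/-!
# Brown, *Mixed Tate motives over ℤ* (2012) — §4: the coefficients `A^r_{a,b}`, `B^r_{a,b}`, `c_w`
# and their `2`-adic properties (Corollary 4.4)

Sibling file in the cone of the named fact
`Literature.NumberTheory.Transcendental.hoffmanSpan_eq_mzvSpace` (Brown 2012, Theorem 1.1),
vendoring the elementary arithmetic of §4 of Brown's proof. Zagier's theorem (Brown's Theorem 4.1)
evaluates `ζ(2^{a} 3 2^{b}) = 2 ∑_{r=1}^{a+b+1} (-1)ʳ (A^r_{a,b} - B^r_{a,b}) ζ(2r+1) ζ(2^{a+b+1-r})`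
(in Brown's summation convention `0 < k₁ < ⋯ < k_r`, eq. (1.1) of the paper, so that Brown's
`ζ(2^{a} 3 2^{b})` is `multipleZeta (List.replicate b 2 ++ 3 :: List.replicate a 2)` in the
decreasing convention of `Literature.NumberTheory.Transcendental.multipleZeta`; e.g. `a = 1, b = 0`
is `multipleZeta [3, 2] = 3 ζ(2)ζ(3) - (11/2) ζ(5)`, cf. `multipleZeta_three_two_eq`), with
`A^r_{a,b} = C(2r, 2a+2)`, `B^r_{a,b} = (1 - 2^{-2r}) C(2r, 2b+1)`
(Brown 2012, §4, display before Theorem 4.1), and the coefficient of `ζ(2n+1)`, `n = a + b + 1`, is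
`c_w = 2 (-1)^{a+b+1} (A^{a+b+1}_{a,b} - B^{a+b+1}_{a,b})` for `w = 2^{a} 3 2^{b}` (eq. (4.2)).
We define these three rational quantities and PROVE Brown's **Corollary 4.4** (the "key arithmetic
input", §4.2): `c_w ∈ ℤ[1/2]`, (1) `c_w - c_{w̃} ∈ 2ℤ` (`w̃ = 2^{b} 3 2^{a}` the reversed word), and
(2) `v₂(c_{3 2^{a+b}}) ≤ v₂(c_w) ≤ 0`, through Brown's explicit formula
`v₂(c_w) = 2 - 2n + v₂(n) + v₂(C(2n-1, 2b))` (proof of Cor. 4.4, p. 13 of arXiv:1102.1312).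

* `Brown2012.zagierA r a`, `Brown2012.zagierB r b`, `Brown2012.zagierCoeff a b` — the definitions;
* `Brown2012.zagierCoeff_sub_zagierCoeff_swap` — Cor. 4.4 (1);
* `Brown2012.padicValRat_zagierCoeff` — the displayed valuation formula;
* `Brown2012.padicValRat_zagierCoeff_le_zero`, `Brown2012.padicValRat_zagierCoeff_three_twos_le` —
  Cor. 4.4 (2); `Brown2012.zagierCoeff_ne_zero`; `Brown2012.zagierCoeff_mem_int_half` (`c_w ∈ ℤ[½]`).

## References

* F. Brown, *Mixed Tate motives over ℤ*, Ann. of Math. **175** (2012), 949–976, §4 (Theorem 4.1,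
  eq. (4.2), Corollary 4.4) (arXiv:1102.1312, pp. 11–13). [Brown2012]
* D. Zagier, *Evaluation of the multiple zeta values `ζ(2,…,2,3,2,…,2)`*, Ann. of Math. **175**
  (2012), 977–1000. [Zagier2012]
-/

namespace Literature.NumberTheory.Transcendental

namespace Brown2012

/-- Brown's `A^r_{a,b} = C(2r, 2a+2)` (it depends only on `r, a`), the first binomial coefficient
in Zagier's evaluation of `ζ(2^{a} 3 2^{b})`. [cite: Brown2012, §4 (before Theorem 4.1)] -/
def zagierA (r a : ℕ) : ℚ := (Nat.choose (2 * r) (2 * a + 2) : ℚ)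

/-- Brown's `B^r_{a,b} = (1 - 2^{-2r}) C(2r, 2b+1)` (it depends only on `r, b`).
[cite: Brown2012, §4 (before Theorem 4.1)] -/
def zagierB (r b : ℕ) : ℚ := (1 - ((2 : ℚ) ^ (2 * r))⁻¹) * (Nat.choose (2 * r) (2 * b + 1) : ℚ)

/-- The coefficient `c_w = 2 (-1)^{a+b+1} (A^{a+b+1}_{a,b} - B^{a+b+1}_{a,b})` of `ζᵐ(2n+1)`
(`n = a + b + 1`) in the motivic Zagier formula for `w = 2^{a} 3 2^{b}` (Brown 2012, Theorem 4.3,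
eq. (4.2)). [cite: Brown2012, Theorem 4.3 eq. (4.2)] -/
def zagierCoeff (a b : ℕ) : ℚ :=
  2 * (-1) ^ (a + b + 1) * (zagierA (a + b + 1) a - zagierB (a + b + 1) b)

/-! ### API -/

/-- Unfolding `zagierA`. [folklore] -/
theorem zagierA_def (r a : ℕ) : zagierA r a = (Nat.choose (2 * r) (2 * a + 2) : ℚ) := rfl

/-- Unfolding `zagierB`. [folklore] -/
theorem zagierB_def (r b : ℕ) :
    zagierB r b = (1 - ((2 : ℚ) ^ (2 * r))⁻¹) * (Nat.choose (2 * r) (2 * b + 1) : ℚ) := rfl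

/-- Unfolding `zagierCoeff`. [folklore] -/
theorem zagierCoeff_def (a b : ℕ) : zagierCoeff a b =
    2 * (-1) ^ (a + b + 1) * (zagierA (a + b + 1) a - zagierB (a + b + 1) b) := rfl

/-- `B^{a+b+1}_{a,b} = B^{a+b+1}_{b,a}`: the symmetry `C(2n, 2b+1) = C(2n, 2a+1)` for
`n = a + b + 1` used in the proof of Cor. 4.4 (1). [cite: Brown2012, proof of Corollary 4.4] -/
theorem zagierB_symm (a b : ℕ) : zagierB (a + b + 1) b = zagierB (a + b + 1) a := by
  rw [zagierB_def, zagierB_def, Nat.choose_symm_of_eq_add (a := 2 * b + 1) (b := 2 * a + 1) (by ring)]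

/-- The decomposition `c_w = X + Y` with `X = 2(-1)ⁿ (C(2n,2a+2) - C(2n,2b+1)) ∈ 2ℤ` and
`Y = (-1)ⁿ 2^{1-2n} C(2n, 2b+1)` (`n = a+b+1`). [cite: Brown2012, proof of Corollary 4.4] -/
theorem zagierCoeff_eq (a b : ℕ) : zagierCoeff a b =
    2 * (-1) ^ (a + b + 1) *
        ((Nat.choose (2 * (a + b + 1)) (2 * a + 2) : ℚ) - Nat.choose (2 * (a + b + 1)) (2 * b + 1)) +
      (-1) ^ (a + b + 1) * 2 * (Nat.choose (2 * (a + b + 1)) (2 * b + 1) : ℚ) /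
        (2 : ℚ) ^ (2 * (a + b + 1)) := by
  rw [zagierCoeff_def, zagierA_def, zagierB_def]
  have h : (2 : ℚ) ^ (2 * (a + b + 1)) ≠ 0 := by positivity
  field_simp
  ring

/-- **Brown 2012, Corollary 4.4 (1)**: `c_w - c_{w̃} ∈ 2ℤ`, where for `w = 2^{a} 3 2^{b}` the
reversed word is `w̃ = 2^{b} 3 2^{a}`; indeed `c_w - c_{w̃} = ± 2 (A^{n}_{a,b} - A^{n}_{b,a})` by the
symmetry of `B`. [cite: Brown2012, Corollary 4.4 (1)] -/
theorem zagierCoeff_sub_zagierCoeff_swap (a b : ℕ) :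
    ∃ z : ℤ, zagierCoeff a b - zagierCoeff b a = 2 * z := by
  refine ⟨(-1) ^ (a + b + 1) *
    ((Nat.choose (2 * (a + b + 1)) (2 * a + 2) : ℤ) - Nat.choose (2 * (a + b + 1)) (2 * b + 2)), ?_⟩
  rw [zagierCoeff_def, zagierCoeff_def, show b + a + 1 = a + b + 1 by ring, ← zagierB_symm a b,
    zagierA_def, zagierA_def]
  push_cast
  ring

/-- `c_w ∈ ℤ[1/2]`: `2^{2n} c_w ∈ ℤ` (`n = a + b + 1`), "obvious from formula (4.2)".
[cite: Brown2012, Corollary 4.4] -/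
theorem zagierCoeff_mem_int_half (a b : ℕ) :
    ∃ z : ℤ, zagierCoeff a b = z / (2 : ℚ) ^ (2 * (a + b + 1)) := by
  refine ⟨2 * (-1) ^ (a + b + 1) *
      ((Nat.choose (2 * (a + b + 1)) (2 * a + 2) : ℤ) - Nat.choose (2 * (a + b + 1)) (2 * b + 1)) *
        2 ^ (2 * (a + b + 1)) +
      (-1) ^ (a + b + 1) * 2 * (Nat.choose (2 * (a + b + 1)) (2 * b + 1) : ℤ), ?_⟩
  rw [zagierCoeff_eq]
  have h : (2 : ℚ) ^ (2 * (a + b + 1)) ≠ 0 := by positivity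
  push_cast
  field_simp

/-! ### The `2`-adic valuation of `c_w` -/

/-- `v₂(C(2n, 2b+1)) = 1 + v₂(n) + v₂(C(2n-1, 2b))` for `b < n`, from
`C(2n, 2b+1) (2b+1) = 2n C(2n-1, 2b)` ("writing `C(2n,2b+1) = (2n/(2b+1)) C(2n-1,2b)`").
[cite: Brown2012, proof of Corollary 4.4] -/
theorem padicValNat_choose_two_mul (n b : ℕ) (hb : b < n) :
    padicValNat 2 (Nat.choose (2 * n) (2 * b + 1)) =
      1 + padicValNat 2 n + padicValNat 2 (Nat.choose (2 * n - 1) (2 * b)) := by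
  have hn : n ≠ 0 := by omega
  have key : 2 * n * Nat.choose (2 * n - 1) (2 * b) = Nat.choose (2 * n) (2 * b + 1) * (2 * b + 1) := by
    have h := Nat.add_one_mul_choose_eq (2 * n - 1) (2 * b)
    rwa [show 2 * n - 1 + 1 = 2 * n by omega] at h
  have hc1 : Nat.choose (2 * n - 1) (2 * b) ≠ 0 := Nat.choose_ne_zero (by omega)
  have hc2 : Nat.choose (2 * n) (2 * b + 1) ≠ 0 := Nat.choose_ne_zero (by omega)
  have hv := congrArg (padicValNat 2) key
  rw [padicValNat.mul (by omega) hc1, padicValNat.mul hc2 (by omega),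
    padicValNat.mul two_ne_zero hn, padicValNat.self one_lt_two,
    padicValNat.eq_zero_of_not_dvd (show ¬ 2 ∣ 2 * b + 1 by omega)] at hv
  omega

/-- `2n ≤ 2ⁿ`. [folklore] -/
theorem two_mul_le_two_pow : ∀ n : ℕ, 2 * n ≤ 2 ^ n
  | 0 => by norm_num
  | 1 => by norm_num
  | n + 2 => by
      have h := two_mul_le_two_pow (n + 1)
      have h2 : 2 ≤ 2 ^ (n + 1) := by
        calc (2 : ℕ) = 2 ^ 1 := by norm_num
          _ ≤ 2 ^ (n + 1) := Nat.pow_le_pow_right (by norm_num) (by omega)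
      calc 2 * (n + 2) = 2 * (n + 1) + 2 := by ring
        _ ≤ 2 ^ (n + 1) + 2 ^ (n + 1) := Nat.add_le_add h h2
        _ = 2 ^ (n + 2) := by ring

/-- `v₂(C(2n-1, 2b)) ≤ n - 1` and `v₂(n) ≤ n - 1`: so `2 - 2n + v₂(n) + v₂(C(2n-1,2b)) ≤ 0`
("which is `≤ 0`"). [cite: Brown2012, proof of Corollary 4.4] -/
theorem padicValNat_add_padicValNat_choose_le (n b : ℕ) (hn : n ≠ 0) :
    padicValNat 2 n + padicValNat 2 (Nat.choose (2 * n - 1) (2 * b)) + 2 ≤ 2 * n := by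
  have h1 : padicValNat 2 n ≤ n - 1 := by
    have h := padicValNat_le_nat_log (p := 2) n
    have hl : Nat.log 2 n < n := Nat.log_lt_of_lt_pow hn (Nat.lt_pow_self one_lt_two)
    omega
  have h2 : padicValNat 2 (Nat.choose (2 * n - 1) (2 * b)) ≤ n - 1 := by
    have h := Nat.factorization_choose_le_log (p := 2) (n := 2 * n - 1) (k := 2 * b)
    rw [Nat.factorization_def _ Nat.prime_two] at h
    have hl : Nat.log 2 (2 * n - 1) < n :=
      Nat.log_lt_of_lt_pow (by omega) (by have := two_mul_le_two_pow n; omega)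
    omega
  omega

/-- **Brown's formula for `v₂(c_w)`** (proof of Corollary 4.4): for `w = 2^{a} 3 2^{b}`, `n = a+b+1`,
`v₂(c_w) = 1 - 2n + v₂(C(2n, 2b+1)) = 2 - 2n + v₂(n) + v₂(C(2n-1, 2b))`, and `c_w ≠ 0`.
[cite: Brown2012, proof of Corollary 4.4] -/
theorem padicValRat_zagierCoeff (a b : ℕ) :
    zagierCoeff a b ≠ 0 ∧
      padicValRat 2 (zagierCoeff a b) =
        2 - 2 * ((a + b + 1 : ℕ) : ℤ) + padicValNat 2 (a + b + 1) +
          padicValNat 2 (Nat.choose (2 * (a + b + 1) - 1) (2 * b)) := by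
  set n := a + b + 1 with hn
  have hn0 : n ≠ 0 := by omega
  have hbn : b < n := by omega
  -- `c = X + Y`
  set X : ℚ := 2 * (-1) ^ n * ((Nat.choose (2 * n) (2 * a + 2) : ℚ) - Nat.choose (2 * n) (2 * b + 1))
    with hX
  set Y : ℚ := (-1) ^ n * 2 * (Nat.choose (2 * n) (2 * b + 1) : ℚ) / (2 : ℚ) ^ (2 * n) with hY
  have hc : zagierCoeff a b = X + Y := by rw [zagierCoeff_eq]
  -- valuation of `Y`
  have hC : (Nat.choose (2 * n) (2 * b + 1) : ℚ) ≠ 0 := by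
    exact_mod_cast Nat.choose_ne_zero (by omega)
  have hY0 : Y ≠ 0 := by
    rw [hY]
    exact div_ne_zero (mul_ne_zero (mul_ne_zero (pow_ne_zero _ (by norm_num)) two_ne_zero) hC)
      (by positivity)
  have hvY : padicValRat 2 Y = 2 - 2 * (n : ℤ) + padicValNat 2 n +
      padicValNat 2 (Nat.choose (2 * n - 1) (2 * b)) := by
    rw [hY, padicValRat.div (mul_ne_zero (mul_ne_zero (pow_ne_zero _ (by norm_num)) two_ne_zero) hC)
        (by positivity),
      padicValRat.mul (mul_ne_zero (pow_ne_zero _ (by norm_num)) two_ne_zero) hC,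
      padicValRat.mul (pow_ne_zero _ (by norm_num)) two_ne_zero,
      padicValRat.pow _, padicValRat.neg, padicValRat.one, padicValRat.pow _,
      show padicValRat 2 (2 : ℚ) = 1 from padicValRat.self one_lt_two,
      show ((Nat.choose (2 * n) (2 * b + 1) : ℕ) : ℚ) = ((Nat.choose (2 * n) (2 * b + 1) : ℕ) : ℚ)
        from rfl,
      padicValRat.of_nat, padicValNat_choose_two_mul n b hbn]
    push_cast
    ring
  have hvY_le : padicValRat 2 Y ≤ 0 := by
    rw [hvY]
    have h := padicValNat_add_padicValNat_choose_le n b hn0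
    omega
  -- `X ∈ 2ℤ`: either `X = 0` or `v₂(X) ≥ 1`
  have hvc : padicValRat 2 (zagierCoeff a b) = padicValRat 2 Y ∧ zagierCoeff a b ≠ 0 := by
    rw [hc]
    by_cases hX0 : X = 0
    · rw [hX0, zero_add]; exact ⟨rfl, hY0⟩
    · have hvX : 1 ≤ padicValRat 2 X := by
        set z : ℤ := (Nat.choose (2 * n) (2 * a + 2) : ℤ) - Nat.choose (2 * n) (2 * b + 1) with hz
        have hXz : X = 2 * ((-1) ^ n * z : ℤ) := by rw [hX, hz]; push_cast; ring
        have hz0 : ((-1) ^ n * z : ℤ) ≠ 0 := by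
          intro h0
          apply hX0
          rw [hXz, h0]
          simp
        rw [hXz, padicValRat.mul two_ne_zero (by exact_mod_cast hz0),
          show padicValRat 2 (2 : ℚ) = 1 from padicValRat.self one_lt_two, padicValRat.of_int]
        have : 0 ≤ padicValInt 2 ((-1) ^ n * z) := by
          rw [padicValInt]; positivity
        omega
      have hlt : padicValRat 2 Y < padicValRat 2 X := by linarith
      have hsum : Y + X ≠ 0 := by
        intro h0
        have hYX : Y = -X := by linarith
        rw [hYX, padicValRat.neg] at hlt
        exact lt_irrefl _ hlt
      rw [add_comm]
      exact ⟨padicValRat.add_eq_of_lt hsum hY0 hX0 hlt, hsum⟩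
  refine ⟨hvc.2, ?_⟩
  rw [hvc.1, hvY]

/-- `c_w ≠ 0`. [cite: Brown2012, Corollary 4.4] -/
theorem zagierCoeff_ne_zero (a b : ℕ) : zagierCoeff a b ≠ 0 := (padicValRat_zagierCoeff a b).1

/-- **Brown 2012, Corollary 4.4 (2), upper bound**: `v₂(c_w) ≤ 0` for every `w = 2^{a} 3 2^{b}`.
[cite: Brown2012, Corollary 4.4 (2)] -/
theorem padicValRat_zagierCoeff_le_zero (a b : ℕ) : padicValRat 2 (zagierCoeff a b) ≤ 0 := by
  rw [(padicValRat_zagierCoeff a b).2]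
  have h := padicValNat_add_padicValNat_choose_le (a + b + 1) b (by omega)
  omega

/-- **Brown 2012, Corollary 4.4 (2), lower bound**: `v₂(c_{3 2^{a+b}}) ≤ v₂(c_{2^{a} 3 2^{b}})` — among
the words of weight `2n + 1` with a single `3`, the coefficient of `w = 3 2^{n-1}` has the least
`2`-adic valuation, `2 - 2n + v₂(n)` ("`v₂(C(2n-1, 2b))` is minimal when `b = 0`", in the reversed
indexing). [cite: Brown2012, Corollary 4.4 (2)] -/
theorem padicValRat_zagierCoeff_three_twos_le (a b : ℕ) :
    padicValRat 2 (zagierCoeff 0 (a + b)) ≤ padicValRat 2 (zagierCoeff a b) := by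
  rw [(padicValRat_zagierCoeff 0 (a + b)).2, (padicValRat_zagierCoeff a b).2,
    show 0 + (a + b) + 1 = a + b + 1 by ring]
  have h1 : Nat.choose (2 * (a + b + 1) - 1) (2 * (a + b)) = 2 * (a + b) + 1 := by
    rw [show 2 * (a + b + 1) - 1 = 2 * (a + b) + 1 by omega, Nat.choose_succ_self_right]
  rw [h1, padicValNat.eq_zero_of_not_dvd (show ¬ 2 ∣ 2 * (a + b) + 1 by omega)]
  have : (0 : ℤ) ≤ padicValNat 2 (Nat.choose (2 * (a + b + 1) - 1) (2 * b)) := by positivity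
  omega

/-- The valuation of the extremal coefficient: `v₂(c_{3 2^{n-1}}) = 2 - 2n + v₂(n)`.
[cite: Brown2012, proof of Corollary 4.4] -/
theorem padicValRat_zagierCoeff_zero (m : ℕ) :
    padicValRat 2 (zagierCoeff 0 m) = 2 - 2 * ((m + 1 : ℕ) : ℤ) + padicValNat 2 (m + 1) := by
  rw [(padicValRat_zagierCoeff 0 m).2, show 0 + m + 1 = m + 1 by ring]
  have h1 : Nat.choose (2 * (m + 1) - 1) (2 * m) = 2 * m + 1 := by
    rw [show 2 * (m + 1) - 1 = 2 * m + 1 by omega, Nat.choose_succ_self_right]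
  rw [h1, padicValNat.eq_zero_of_not_dvd (show ¬ 2 ∣ 2 * m + 1 by omega)]
  push_cast
  ring

end Brown2012

end Literature.NumberTheory.Transcendental
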